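import Summits.Ventures.Crystal3D.Theorems.StickyWulffConstantNoReconstructionGainSymmetry
import Summits.Ventures.Crystal3D.Theorems.StickyWulffConstantNoReconstructionGainCellFluxChain
import HarnessLib

/-!
# The CellFlux / blanket chain on the whole `(111)` orbit

HONEST FRAMING. Part of the venture `Summits/Ventures/Crystal3D` (cell `crystal3d-full`), helper
`--supports` the crux `NoReconstructionGain` (stmt-Ventures-19144, route
`route-Ventures-StickyWulffConstant`), line `adhesion`.  Bookkeeping: g5's chain
`PoolFluxBound a κ ⇒ BlanketBound ⇒ NoReconstructionGain at e₃` (`…CellFluxChain`, `R = 1`, `C = 4π`)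
composed with the lattice-symmetry transport of `…Symmetry` (`noReconstructionGainAt_transport`):

* `blanketBound_noReconstructionGain_transport` — cf-p1's landed `CellFlux.BlanketBound` implies the
  crux body (`R = 1`, `C = 4π`) at `g e₃` for EVERY linear isometry `g` of `ℝ³` with `g Λ₀ = Λ₀`
  (all eight hexagonal normals; supersedes the bond-mirror special cases of `…Symmetry`);
* `poolFlux_noReconstructionGain_transport` — the same from the pool local lemma `PoolFluxBound a κ`
  (`1/√3 ≤ a`, `0 < a`, `0 < κ`).

WHAT THIS IS NOT: `BlanketBound` and `PoolFluxBound fluxRadius 1` are conjectures (censused,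
unproved); other orbits; rung F-C1 not moved.
-/

noncomputable section

namespace Summit.Ventures.Crystal3D.Theorems

open Summit.Ventures.Crystal3D Finset MeasureTheory
open Summit.Ventures.Crystal3D.Cruxes.NoReconstructionGain.CellFlux
open Literature.MathematicalPhysics.StatisticalMechanics (fccStacking)
open scoped InnerProductSpace

/-- **`BlanketBound ⇒ NoReconstructionGain` on the whole `(111)` orbit** (`R = 1`, `C = 4π`). -/
theorem blanketBound_noReconstructionGain_transport :
    Summit.Ventures.Crystal3D.Cruxes.NoReconstructionGain.CellFlux.BlanketBound →
    ∃ R C : ℝ, 0 < R ∧ ∀ g : EuclideanSpace ℝ (Fin 3) ≃ₗᵢ[ℝ] EuclideanSpace ℝ (Fin 3),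
    (∀ p ∈ Literature.MathematicalPhysics.StatisticalMechanics.fccStacking 1 (Real.sqrt (2 / 3)),
      g p ∈ Literature.MathematicalPhysics.StatisticalMechanics.fccStacking 1 (Real.sqrt (2 / 3))) →
    (∀ p ∈ Literature.MathematicalPhysics.StatisticalMechanics.fccStacking 1 (Real.sqrt (2 / 3)),
      g.symm p ∈ Literature.MathematicalPhysics.StatisticalMechanics.fccStacking 1 (Real.sqrt (2 / 3))) →
    ∀ ρ : ℝ, R ≤ ρ → ∀ (N : ℕ) (x : Fin N → EuclideanSpace ℝ (Fin 3)),
      Summit.Ventures.Crystal3D.IsUnitPacking x →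
      (∀ p ∈ Literature.MathematicalPhysics.StatisticalMechanics.fccStacking 1 (Real.sqrt (2 / 3)),
          -(2 * R) ≤ ⟪p, g (EuclideanSpace.single (2 : Fin 3) (1 : ℝ))⟫_ℝ →
          ⟪p, g (EuclideanSpace.single (2 : Fin 3) (1 : ℝ))⟫_ℝ ≤ -R →
          ‖p‖ ^ 2 - ⟪p, g (EuclideanSpace.single (2 : Fin 3) (1 : ℝ))⟫_ℝ ^ 2 ≤ ρ ^ 2 → ∃ i, x i = p) →
        2 * (Real.sqrt 2 / 4 *
              ∑ᶠ w ∈ {w ∈ Literature.MathematicalPhysics.StatisticalMechanics.fccStacking 1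
                (Real.sqrt (2 / 3)) | ‖w‖ = 1}, |⟪w, g (EuclideanSpace.single (2 : Fin 3) (1 : ℝ))⟫_ℝ|) *
            Real.pi * ρ ^ 2 - C * ρ ≤ 6 * (N : ℝ) - (Summit.Ventures.Crystal3D.numContacts x : ℝ) := by
  intro hB
  obtain ⟨R, C, hR, h⟩ := noReconstructionGainAt_e3_of_blanketBound hB
  exact ⟨R, C, hR, fun g hg hg' => noReconstructionGainAt_transport g hg hg' _ R C h⟩

/-- **`PoolFluxBound ⇒ NoReconstructionGain` on the whole `(111)` orbit** (`R = 1`, `C = 4π`): for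
semi-axes `1/√3 ≤ a`, `0 < a`, `0 < κ`, the pool local lemma implies the crux body at every `g e₃`. -/
theorem poolFlux_noReconstructionGain_transport :
    ∀ a κ : ℝ, Summit.Ventures.Crystal3D.Cruxes.NoReconstructionGain.CellFlux.blanketRadius ≤ a → 0 < a →
    0 < κ → Summit.Ventures.Crystal3D.Cruxes.NoReconstructionGain.CellFlux.PoolFluxBound a κ →
    ∃ R C : ℝ, 0 < R ∧ ∀ g : EuclideanSpace ℝ (Fin 3) ≃ₗᵢ[ℝ] EuclideanSpace ℝ (Fin 3),
    (∀ p ∈ Literature.MathematicalPhysics.StatisticalMechanics.fccStacking 1 (Real.sqrt (2 / 3)),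
      g p ∈ Literature.MathematicalPhysics.StatisticalMechanics.fccStacking 1 (Real.sqrt (2 / 3))) →
    (∀ p ∈ Literature.MathematicalPhysics.StatisticalMechanics.fccStacking 1 (Real.sqrt (2 / 3)),
      g.symm p ∈ Literature.MathematicalPhysics.StatisticalMechanics.fccStacking 1 (Real.sqrt (2 / 3))) →
    ∀ ρ : ℝ, R ≤ ρ → ∀ (N : ℕ) (x : Fin N → EuclideanSpace ℝ (Fin 3)),
      Summit.Ventures.Crystal3D.IsUnitPacking x →
      (∀ p ∈ Literature.MathematicalPhysics.StatisticalMechanics.fccStacking 1 (Real.sqrt (2 / 3)),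
          -(2 * R) ≤ ⟪p, g (EuclideanSpace.single (2 : Fin 3) (1 : ℝ))⟫_ℝ →
          ⟪p, g (EuclideanSpace.single (2 : Fin 3) (1 : ℝ))⟫_ℝ ≤ -R →
          ‖p‖ ^ 2 - ⟪p, g (EuclideanSpace.single (2 : Fin 3) (1 : ℝ))⟫_ℝ ^ 2 ≤ ρ ^ 2 → ∃ i, x i = p) →
        2 * (Real.sqrt 2 / 4 *
              ∑ᶠ w ∈ {w ∈ Literature.MathematicalPhysics.StatisticalMechanics.fccStacking 1
                (Real.sqrt (2 / 3)) | ‖w‖ = 1}, |⟪w, g (EuclideanSpace.single (2 : Fin 3) (1 : ℝ))⟫_ℝ|) *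
            Real.pi * ρ ^ 2 - C * ρ ≤ 6 * (N : ℝ) - (Summit.Ventures.Crystal3D.numContacts x : ℝ) := by
  intro a κ hr ha hκ hpool
  obtain ⟨R, C, hR, h⟩ := noReconstructionGainAt_e3_of_poolFluxBound a κ hr ha hκ hpool
  exact ⟨R, C, hR, fun g hg hg' => noReconstructionGainAt_transport g hg hg' _ R C h⟩

end Summit.Ventures.Crystal3D.Theorems
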